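import Summits.BirchSwinnertonDyer.BirchSwinnertonDyer.Theorems.EisensteinPrimesUnrSelmerImprimitiveLambdaShift
import HarnessLib

/-!
# The imprimitive unramified Selmer dual `𝔛^{S₂}` of a GENERIC `p`-primary module is finitely
# generated, `Λ`-torsion, `μ(𝔛^{S₂}) = μ(𝔛^{S₁})` and `λ(𝔛^{S₂}) = λ(𝔛^{S₁}) + corank` as soon as
# `𝔛^{S₁}` is f.g. torsion and the `p`-torsion of `H¹_{𝓕_nr^{S₂}}/H¹_{𝓕_nr^{S₁}}` is FINITE

Cell `bsd-eis` (home `run/shared/lean/pub/bsd-eis/`), seat `bsd-eis-k5-c2` g11, crux 2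
`GoodLatticeBDPValue` (stmt-BirchSwinnertonDyer-19032), line `halves`, OPTION (B0), refinement (ii) of
HOME/k5-c2-MEMO-11.md §2: the sibling `UnrSelmerImprimitiveLambdaShift` (p565030) proves the
`λ`-shift assuming the IMPRIMITIVE dual is f.g. torsion with `μ = 0` (the first clause of KY/CGLS
Prop. 1.2.5, typed in `prop125_residualPair_unrSelmer_imprimitive`). Here that clause is DERIVED in
the kernel from the PRIMITIVE dual (Rubin–Hida, KY/CGLS Thm. 1.2.2) and the finiteness of the
`p`-torsion of the quotient `Q = H¹_{𝓕_nr^{S₂}}/H¹_{𝓕_nr^{S₁}}` (which is what Pollack–Weston A.2 ∘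
Lemma 1.1.1 give: `Q ≅ ∏_{w∈S} H¹(K_w, M_θ)` with f.g. torsion `μ = 0` duals) — Greenberg–Vatsal 2000
Cor. (2.3) conclusions 1–3 for a GENERIC module, the port of b2b's
`Iwasawa.datumSelmer_nonPrimitive_moduleFinite_isTorsion_mu_eq` (hard-wired to `W.geomPrimaryTorsion p`
and to a local cover lemma) with the cover REPLACED by the hypothesis `Finite (Q[p])`.

HONEST FRAMING: tool theorems only (no definition, no named fact, no `sorry`), generic discrete
`p`-primary `Γ_K`-module `M` with open stabilisers, any number field, any `ℤ_p`-extension; BSD is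
proved for no curve; no label or count moves. What is NOT here: the finiteness of `Q[p]` itself (for
`M = E[p^∞]` b2b's `DatumSelmerLocalIndexFinite`; for a character module it is the local input).

## What (notation of the sibling: `Sel^{Sᵢ} = unrSelmer κ M vbar Sᵢ`, `X` / `X₀` dual data of `Sel^{S₁}` / `Sel^{S₂}`)
* §1 `isDualPair_datumDualData` — any dual datum is an `IwasawaDual.IsDualPair` for `ψ = conj_γ − 1`.
* §2 `exists_finset_cover_of_finite_torsionBy` — `Q[p]` finite ⇒ a finite-coset cover of
  `{s ∈ Sel^{S₂} | p s ∈ Sel^{S₁}}`; `finite_piece_one_imprimitive` — `Sel^{S₁}[𝔪]` finite ⇒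
  `Sel^{S₂}[𝔪]` finite (slices of the cover are translates of `Sel^{S₁}[𝔪]`).
* §3 **`moduleFinite_isTorsion_mu_lambda_of_primitive`**: `X` f.g. torsion and `Q[p]` finite ⇒ `X₀`
  f.g. (Nakayama on the dual pair), torsion (`(ker r)/p` finite for the dual restriction `r : X₀ ↠ X`,
  `ker r ≅ Hom(Q, ℚ/ℤ)`), `μ(X₀) = μ(X)`, and `λ(X₀) = λ(X) + corank_{ℤ_p}(Q)`.

References: Greenberg–Vatsal 2000 §2 Cor. (2.3), pp. 20–21; Greenberg LNM 1716 §1 p. 60; KY 2024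
Prop. 1.2.5 (TeX L780–800).
-/

set_option linter.dupNamespace false
set_option autoImplicit false

noncomputable section

open scoped Classical AddSubgroup

open NumberField IsDedekindDomain Field
open Summit.BirchSwinnertonDyer.Rank1Residual
open Literature.NumberTheory.EllipticCurves Literature.NumberTheory.EllipticCurves.GreenbergSelmer
  Literature.NumberTheory.EllipticCurves.GreenbergVatsal2000
  Literature.NumberTheory.EllipticCurves.IwasawaDual
  Literature.NumberTheory.EllipticCurves.KellerYin2024
  Literature.NumberTheory.GaloisRepresentations
open Summit.BirchSwinnertonDyer.BirchSwinnertonDyer.Theorems.UnrSelmerImprimitiveLambdaShift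

universe u

namespace Summit.BirchSwinnertonDyer.BirchSwinnertonDyer.Theorems.UnrSelmerImprimitiveFiniteness

variable {K : Type u} [Field K] [NumberField K] {p : ℕ} [Fact p.Prime] (κ : ZpExtension K p)
  {M : Type u} [AddCommGroup M] [DistribMulAction (absoluteGaloisGroup K) M] [TopologicalSpace M]
  [DiscreteTopology M] (vbar : HeightOneSpectrum (𝓞 K))

/-! ## §1. A datum dual of `H¹_{𝓕_nr^S}(K_∞, M)` is a dual pair -/

/-- Every `DatumDualData` of `H¹_{𝓕_nr^{S₀}}(K_∞, M)` is an axiomatic Pontryagin dual pair for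
`ψ = conj_γ − 1` (`conjUnr`): `toDual_T_smul`, `toDual_C_smul`, and local nilpotence
`isLocNil_conjUnr_sub_one` for `γ` a topological generator (port of b2b
`Iwasawa.isDualPair_datumDualData`). [cite: GreenbergLNM1716, §1 (after Conj. 1.3)] -/
theorem isDualPair_datumDualData (htor : ∀ m : M, ∃ k : ℕ, p ^ k • m = 0)
    (hstab : ∀ m : M, IsOpen (MulAction.stabilizer (absoluteGaloisGroup K) m : Set (absoluteGaloisGroup K)))
    {γ : absoluteGaloisGroup K} (hγ : κ.IsTopGenerator γ) (S₀ : Set (HeightOneSpectrum (𝓞 K)))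
    (D : DatumDualData κ γ M (Castella2018.AcSelmer.bdpData M p vbar) S₀) :
    IsDualPair p (conjUnr κ M vbar S₀ γ - 1) D.toDual where
  bijective := D.bijective
  T_smul x s := by
    rw [D.toDual_T_smul, IwasawaDual.End_sub_apply, AddMonoid.End.one_apply, map_sub]
    rfl
  C_smul c x s k hk := D.toDual_C_smul c x s k hk
  locNil := isLocNil_conjUnr_sub_one κ vbar S₀ htor hstab hγ

/-! ## §2. `Q[p]` finite ⇒ a finite-coset cover; `Sel^{S₁}[𝔪]` finite ⇒ `Sel^{S₂}[𝔪]` finite -/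

/-- **A finite-coset cover from `Q[p]` finite**: if the `p`-torsion of
`Q = Sel^{S₂}/Sel^{S₁}` is finite, some finite `F ⊆ Sel^{S₂}` meets every class `s + Sel^{S₁}` with
`p s ∈ Sel^{S₁}` (representatives of `Q[p]`). [cite: GreenbergVatsal2000, §2 pp. 20–21] -/
theorem exists_finset_cover_of_finite_torsionBy {S₁ S₂ : Set (HeightOneSpectrum (𝓞 K))}
    (hQ : Finite ((↥(unrSelmer κ M vbar S₂) ⧸
      (unrSelmer κ M vbar S₁).addSubgroupOf (unrSelmer κ M vbar S₂))[(p : ℤ)])) :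
    ∃ F : Finset ↥(unrSelmer κ M vbar S₂), ∀ s : ↥(unrSelmer κ M vbar S₂),
      p • (s : subgroupH1 κ.kerSubgroup M) ∈ unrSelmer κ M vbar S₁ →
        ∃ f ∈ F, (s : subgroupH1 κ.kerSubgroup M) - (f : subgroupH1 κ.kerSubgroup M) ∈
          unrSelmer κ M vbar S₁ := by
  set SS := unrSelmer κ M vbar S₂ with hSS
  set S := unrSelmer κ M vbar S₁ with hS
  set N : AddSubgroup SS := S.addSubgroupOf SS with hN
  have hNmem : ∀ s : SS, s ∈ N ↔ (s : subgroupH1 κ.kerSubgroup M) ∈ S := fun s ↦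
    AddSubgroup.mem_addSubgroupOf
  -- representatives of the finitely many `p`-torsion classes
  have hrep : ∀ q : (SS ⧸ N)[(p : ℤ)], ∃ s : SS, QuotientAddGroup.mk' N s = (q : SS ⧸ N) := fun q ↦
    QuotientAddGroup.mk'_surjective N q
  choose g hg using hrep
  haveI := hQ
  haveI : Fintype ((SS ⧸ N)[(p : ℤ)]) := Fintype.ofFinite _
  refine ⟨Finset.univ.image g, fun s hps ↦ ?_⟩
  have hcls : QuotientAddGroup.mk' N s ∈ (SS ⧸ N)[(p : ℤ)] := by
    refine AddSubgroup.torsionBy.nsmul_iff.mpr ?_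
    rw [← map_nsmul, QuotientAddGroup.mk'_apply, QuotientAddGroup.eq_zero_iff, hNmem,
      AddSubgroupClass.coe_nsmul]
    exact hps
  refine ⟨g ⟨_, hcls⟩, Finset.mem_image_of_mem _ (Finset.mem_univ _), ?_⟩
  have h : QuotientAddGroup.mk' N (g ⟨_, hcls⟩) = QuotientAddGroup.mk' N s := hg ⟨_, hcls⟩
  generalize g ⟨_, hcls⟩ = f at h ⊢
  rw [QuotientAddGroup.mk'_apply, QuotientAddGroup.mk'_apply, QuotientAddGroup.eq_iff_sub_mem, hNmem,
    AddSubgroupClass.coe_sub] at h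
  -- `h : g - s ∈ S`; we want `s - g ∈ S`
  have h' := S.neg_mem h
  rwa [neg_sub] at h'

/-- Membership in `Sel^{S₀}[𝔪] = piece 1` for `ψ = conj_γ − 1`: `p s = 0` and `conj_γ s = s` (on the
underlying classes). [folklore] -/
theorem mem_piece_one_conjUnr_iff (S₀ : Set (HeightOneSpectrum (𝓞 K))) (γ : absoluteGaloisGroup K)
    (s : unrSelmer κ M vbar S₀) :
    s ∈ piece p (conjUnr κ M vbar S₀ γ - 1) 1 ↔
      p • (s : subgroupH1 κ.kerSubgroup M) = 0 ∧
        conjH1 κ.kerSubgroup M γ s = (s : subgroupH1 κ.kerSubgroup M) := by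
  rw [mem_piece, pow_one, pow_one, IwasawaDual.End_sub_apply, AddMonoid.End.one_apply, sub_eq_zero,
    Subtype.ext_iff, Subtype.ext_iff, AddSubgroupClass.coe_nsmul, ZeroMemClass.coe_zero,
    coe_conjUnr_apply]

/-- **`Sel^{S₁}[𝔪]` finite and `Q[p]` finite ⇒ `Sel^{S₂}[𝔪]` finite** (`[𝔪]` = killed by `p` and
fixed by `conj_γ`, the `IwasawaDual.piece … 1` of the tree's Nakayama lemma): an element of
`Sel^{S₂}[𝔪]` has `p s = 0 ∈ Sel^{S₁}`, so lies in one of the finitely many classes `f + Sel^{S₁}` of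
the cover, and two elements of the same class differ by an element of `Sel^{S₁}[𝔪]` (port of b2b
`Iwasawa.finite_piece_one_nonPrimitive_of_finite_piece_one`).
[cite: GreenbergVatsal2000, §2 Cor. (2.3) (arXiv:math/9906215 pp. 20–21)] -/
theorem finite_piece_one_imprimitive {S₁ S₂ : Set (HeightOneSpectrum (𝓞 K))} (h12 : S₁ ⊆ S₂)
    (γ : absoluteGaloisGroup K)
    (hQ : Finite ((↥(unrSelmer κ M vbar S₂) ⧸
      (unrSelmer κ M vbar S₁).addSubgroupOf (unrSelmer κ M vbar S₂))[(p : ℤ)]))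
    (hfin : (piece p (conjUnr κ M vbar S₁ γ - 1) 1 : Set (unrSelmer κ M vbar S₁)).Finite) :
    (piece p (conjUnr κ M vbar S₂ γ - 1) 1 : Set (unrSelmer κ M vbar S₂)).Finite := by
  set SS := unrSelmer κ M vbar S₂ with hSS
  set S := unrSelmer κ M vbar S₁ with hS
  have hle : S ≤ SS := unrSelmer_mono κ M vbar h12
  obtain ⟨F, hF⟩ := exists_finset_cover_of_finite_torsionBy κ vbar hQ
  -- the slices `A_f = {s ∈ Sel^{S₂}[𝔪] | s - f ∈ Sel^{S₁}}`
  have hcover : (piece p (conjUnr κ M vbar S₂ γ - 1) 1 : Set SS) ⊆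
      ⋃ f ∈ F, {s : SS | s ∈ piece p (conjUnr κ M vbar S₂ γ - 1) 1 ∧
        (s : subgroupH1 κ.kerSubgroup M) - f ∈ S} := by
    intro s hs
    have hps : p • (s : subgroupH1 κ.kerSubgroup M) ∈ S := by
      rw [((mem_piece_one_conjUnr_iff κ vbar S₂ γ s).1 hs).1]; exact S.zero_mem
    obtain ⟨f, hfF, hf⟩ := hF s hps
    exact Set.mem_biUnion hfF ⟨hs, hf⟩
  refine (Set.Finite.biUnion F.finite_toSet fun f _ ↦ ?_).subset hcover
  by_cases hne : {s : SS | s ∈ piece p (conjUnr κ M vbar S₂ γ - 1) 1 ∧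
      (s : subgroupH1 κ.kerSubgroup M) - f ∈ S}.Nonempty
  · obtain ⟨s₀, hs₀, hs₀f⟩ := hne
    refine (hfin.image fun t ↦ s₀ + AddSubgroup.inclusion hle t).subset ?_
    rintro s ⟨hs, hsf⟩
    obtain ⟨hps, hcs⟩ := (mem_piece_one_conjUnr_iff κ vbar S₂ γ s).1 hs
    obtain ⟨hps₀, hcs₀⟩ := (mem_piece_one_conjUnr_iff κ vbar S₂ γ s₀).1 hs₀
    have hmem : (s : subgroupH1 κ.kerSubgroup M) - s₀ ∈ S := by
      have e : (s : subgroupH1 κ.kerSubgroup M) - s₀ =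
          ((s : subgroupH1 κ.kerSubgroup M) - f) - ((s₀ : subgroupH1 κ.kerSubgroup M) - f) := by
        abel
      rw [e]; exact S.sub_mem hsf hs₀f
    refine ⟨⟨_, hmem⟩, ?_, ?_⟩
    · rw [SetLike.mem_coe, mem_piece_one_conjUnr_iff]
      refine ⟨?_, ?_⟩
      · change p • ((s : subgroupH1 κ.kerSubgroup M) - s₀) = 0
        rw [smul_sub, hps, hps₀, sub_zero]
      · change conjH1 κ.kerSubgroup M γ ((s : subgroupH1 κ.kerSubgroup M) - s₀) = _
        rw [map_sub, hcs, hcs₀]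
    · apply Subtype.ext
      change (s₀ : subgroupH1 κ.kerSubgroup M) + ((s : subgroupH1 κ.kerSubgroup M) - s₀) = s
      abel
  · rw [Set.not_nonempty_iff_eq_empty.1 hne]
    exact Set.finite_empty

/-! ## §3. `X` f.g. torsion and `Q[p]` finite ⇒ `X₀` f.g. torsion, `μ(X₀) = μ(X)`, `λ(X₀) = λ(X) + corank(Q)` -/

/-- **Greenberg–Vatsal 2000 Cor. (2.3) for a GENERIC module, from the finiteness of `Q[p]`.** For
`M` `p`-primary with open stabilisers, `γ` a topological generator, `S₁ ⊆ S₂`, a dual datum `X` of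
`H¹_{𝓕_nr^{S₁}}(K_∞, M)` that is finitely generated and `Λ`-torsion, any dual datum `X₀` of
`H¹_{𝓕_nr^{S₂}}(K_∞, M)`, and `Q = H¹_{𝓕_nr^{S₂}}/H¹_{𝓕_nr^{S₁}}` with FINITE `p`-torsion: `X₀` is
finitely generated (converse Nakayama on `X` ⇒ `Sel^{S₁}[𝔪]` finite ⇒ `Sel^{S₂}[𝔪]` finite ⇒
Nakayama), `Λ`-torsion (the dual restriction `r : X₀ ↠ X` has `ker r ≅ Hom(Q, ℚ/ℤ)` with
`(ker r)/p ≅ Hom(Q[p], ℚ/ℤ)` finite), `μ(X₀) = μ(X)` (`μ(ker r) = 0`) and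
`λ(X₀) = λ(X) + corank_{ℤ_p}(Q)` (`λ(ker r) = corank_{ℤ_p}(Q)`). In KY/CGLS Prop. 1.2.5 this is the
step "(eq:Gr to imp) … combined with [Rubin Hida] and [H1 Euler] gives the first part": with `X`
f.g. torsion `μ = 0` (Rubin–Hida) and `Q ≅ ∏_{w∈S} H¹(K_w, M_θ)` of finite `p`-torsion, `𝔛_θ^S` is
f.g. torsion with `μ = 0` and `λ(𝔛_θ^S) = λ(𝔛_θ) + corank`.
[cite: GreenbergVatsal2000, §2 Cor. (2.3) and p. 21 (arXiv:math/9906215 pp. 20–21)]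
[cite: KellerYin2024, Prop. 1.2.5 (arXiv:2402.12781v2 TeX L780–800)] -/
theorem moduleFinite_isTorsion_mu_lambda_of_primitive
    (htor : ∀ m : M, ∃ k : ℕ, p ^ k • m = 0)
    (hstab : ∀ m : M, IsOpen (MulAction.stabilizer (absoluteGaloisGroup K) m : Set (absoluteGaloisGroup K)))
    {γ : absoluteGaloisGroup K} (hγ : κ.IsTopGenerator γ) {S₁ S₂ : Set (HeightOneSpectrum (𝓞 K))}
    (h12 : S₁ ⊆ S₂)
    (X : DatumDualData κ γ M (Castella2018.AcSelmer.bdpData M p vbar) S₁)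
    [Module.Finite (IwasawaAlgebra p) X.X] (hXt : Module.IsTorsion (IwasawaAlgebra p) X.X)
    (X₀ : DatumDualData κ γ M (Castella2018.AcSelmer.bdpData M p vbar) S₂)
    (hQ : Finite ((↥(unrSelmer κ M vbar S₂) ⧸
      (unrSelmer κ M vbar S₁).addSubgroupOf (unrSelmer κ M vbar S₂))[(p : ℤ)])) :
    Module.Finite (IwasawaAlgebra p) X₀.X ∧ Module.IsTorsion (IwasawaAlgebra p) X₀.X ∧
      muInvariant p X₀.X = muInvariant p X.X ∧
      lambdaInvariant p X₀.X = lambdaInvariant p X.X +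
        zpCorank (↥(unrSelmer κ M vbar S₂) ⧸
          (unrSelmer κ M vbar S₁).addSubgroupOf (unrSelmer κ M vbar S₂)) p := by
  -- (1) finite generation: converse Nakayama on `X`, the cover, Nakayama on `X₀`
  haveI : Finite (piece p (conjUnr κ M vbar S₁ γ - 1) 1) :=
    Iwasawa.finite_piece_one_of_isDualPair_of_moduleFinite
      (isDualPair_datumDualData κ vbar htor hstab hγ S₁ X)
  have hfin₀ := finite_piece_one_imprimitive κ vbar h12 γ hQ (Set.toFinite _)
  haveI hfg₀ : Module.Finite (IwasawaAlgebra p) X₀.X :=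
    (isDualPair_datumDualData κ vbar htor hstab hγ S₂ X₀).module_finite hfin₀
  -- (2) the dual restriction and its kernel
  obtain ⟨r, -, hsurj, hker⟩ := exists_restrictDual κ vbar htor hstab hγ h12 X X₀
  obtain ⟨Ψ⟩ := nonempty_ker_addEquiv_characterModule κ vbar h12 X₀ r hker
  haveI := hQ
  haveI : Finite (ModN (CharacterModule (↥(unrSelmer κ M vbar S₂) ⧸
      (unrSelmer κ M vbar S₁).addSubgroupOf (unrSelmer κ M vbar S₂))) p) :=
    Iwasawa.finite_modN_characterModule_of_finite_torsionBy (p := p) _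
  haveI : Finite (ModN (LinearMap.ker r) p) :=
    Finite.of_surjective _ (modNMap_surjective (f := Ψ.symm.toAddMonoidHom) (fun y ↦ Ψ.symm.surjective y) p)
  haveI : Module.Finite (IwasawaAlgebra p) (LinearMap.ker r) := Iwasawa.moduleFinite_ker p r
  have hKt : Module.IsTorsion (IwasawaAlgebra p) (LinearMap.ker r) :=
    Iwasawa.isTorsion_of_finite_modN p (LinearMap.ker r)
  have hX₀ : Module.IsTorsion (IwasawaAlgebra p) X₀.X :=
    X2.DualRestrictionInvariants.isTorsion_of_surjective_of_ker p r hKt hXt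
  have hμK : muInvariant p (LinearMap.ker r) = 0 :=
    X2.MuVanishingOfFiniteModP.muInvariant_eq_zero_of_finite_modN p (LinearMap.ker r) hKt
  -- (3) `μ` and `λ`
  obtain ⟨-, hcork⟩ :=
    X2.NonPrimitiveSelmerCorank.finite_torsionBy_and_zpCorank_eq_lambdaInvariant p (LinearMap.ker r)
      hKt hμK (fun q ↦ isPrimary_quotient κ vbar htor (S₁ := S₁) (S₂ := S₂) q) Ψ
  refine ⟨hfg₀, hX₀, ?_, ?_⟩
  · rw [X2.DualRestrictionInvariants.muInvariant_eq_add_of_surjective p r hX₀ hsurj, hμK, zero_add]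
  · rw [X2.DualRestrictionInvariants.lambdaInvariant_eq_add_of_surjective p r hX₀ hsurj, hcork, add_comm]

end Summit.BirchSwinnertonDyer.BirchSwinnertonDyer.Theorems.UnrSelmerImprimitiveFiniteness

end
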